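import Summits.QuantumFields.YangMills.Theorems.ColdStartUniversalityLatticeLangevinHypercontractiveMixing
import Summits.QuantumFields.YangMills.Theorems.ColdStartUniversalityLatticeLangevinLawDensityBoundExplicit
import HarnessLib

/-!
# Route `ColdStartUniversality` (fixed-cut-off package, `Lᵖ` side): ★★★ COLD-START `L²`-MIXING IN `O(log L)` LATTICE TIME at
# `|β'| < 1/12` — the hypercontractive burn-in applied to the explicit density bound of the SZZ dynamics

Helper file (seat `ym-line-csu-p1`, g36; `--supports stmt-QuantumFields-24809`).  SU(2) lattice Langevin dynamics of Shen–Zhu–Zhu at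
`(L, β')` from a DETERMINISTIC start `z` (the cold start `z = 1` included), Wilson measure `μ = μ_{β'}`.  Inputs, all in the tree:
the explicit density bound `law(U₂) ≤ C₁·Haar^{⊗E}`, `C₁ = e^{96|β'|#E + 2|β'|#𝒫}·2(3/2)^{#E}` (`map_le_smul_haar_explicit`, g27) and
`Haar^{⊗E} ≤ e^{8|β'|#𝒫}·μ` (`wilsonMeasure_le_smul_pi_haar_and_explicit`), so `law(U₂) ≤ D·μ` with
`log D = B := 96|β'|#E + 10|β'|#𝒫 + log 2 + #E·log(3/2)` (LINEAR in the volume, `#E = #𝒫 = 3L³`); the Markov property through THE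
transition kernels; and the hypercontractive `L²`-mixing of `…HypercontractiveMixing` (g36).  Results:

* `rpow_one_div_le_exp_of_log_le` — `D^{1/q} ≤ e` when `D ≥ e` and `log D ≤ q` … (the `log log` lemma in the form used here);
* ★★★ `coldStart_hypercontractive_mixing_uniform` — for every `L`, `|β'| < 1/12`, every deterministic start `z`, EVERY strong solution
  `U` from `z` on ANY filtered probability space, every bounded measurable `F`, and all lattice times `t₀, s ≥ 0` with
  `log B ≤ 2(1 − 12|β'|)·t₀`:

  `|E F(U_{2+t₀+s}) − μ_{β'}F| ≤ e · e^{−(1−12|β'|)s} · √Var_{μ_{β'}}(F)`;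

  i.e. the `L²`/χ²-MIXING TIME of the cold-start sampler is `2 + log B/(2(1−12|β'|)) + (1 + log(1/ε))/(1 − 12|β'|) = O(log L)`
  lattice units — against `2 + (B + 2log(1/ε))/(2(1−12|β'|)) = O(L³)` from the Poincaré inequality alone
  (`coldStart_measurable_sq_sub_le_exp_uniform`, g25) — and of the same order as g27's ENTROPY/total-variation time, for the STRONGER
  `L²` distance;
* ★★ `coldStart_hypercontractive_mixing_explicit` — the same at EVERY `(L, β')` with `ρ = ½e^{−4|β'|#𝒫}`, `λ = (3/2)e^{−4|β'|#𝒫}`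
  (condition `log B ≤ 4ρt₀`; honest: there `ρ⁻¹` itself is `e^{O(L³)}`).

THEOREMS ONLY, no definition, no sorry.  HONEST FRAMING: RECORD-rung R3 plumbing at FIXED cut-off in LATTICE units; the volume-free
window `|β'| < 1/12` is the high-temperature regime, not the route's scaling `β'_K = (γε_K)⁻¹/2 → ∞`; nothing K-uniform is proved; no
crux, rung or summit statement is proved; the Yang–Mills mass gap is NOT proved.
-/

set_option autoImplicit false

noncomputable section

namespace Summit.QuantumFields.YangMills.Theorems.ColdStartUniversality

open MeasureTheory ProbabilityTheory Filter Set Topology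
open scoped BigOperators NNReal ENNReal
open Literature.Probability.Process Literature.MathematicalPhysics.QuantumFieldTheory
open Literature.MathematicalPhysics.QuantumLattice (fundamentalRep fundamentalLatticeRep continuous_fundamentalRep)

variable {L : ℕ} [NeZero L]

/-! ## §1. Bookkeeping -/

/-- **`D^{1/q} ≤ e` when `e ≤ D` and `log D ≤ q`.** [folklore] -/
theorem rpow_one_div_le_exp_of_log_le {D q : ℝ} (hD : Real.exp 1 ≤ D) (hq : Real.log D ≤ q) :
    D ^ (1 / q) ≤ Real.exp 1 := by
  have hD1 : 1 ≤ D := le_trans (by have := Real.add_one_le_exp (1 : ℝ); linarith) hD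
  have hD0 : 0 < D := by linarith
  have hlog : 1 ≤ Real.log D := by
    have := Real.log_le_log (Real.exp_pos 1) hD
    rwa [Real.log_exp] at this
  have hq0 : 0 < q := by linarith
  have h1 : D ^ (1 / q) ≤ D ^ (1 / Real.log D) :=
    Real.rpow_le_rpow_of_exponent_le hD1 (by rw [div_le_div_iff₀ hq0 (by linarith)]; linarith)
  have h2 : D ^ (1 / Real.log D) = Real.exp 1 := by
    rw [Real.rpow_def_of_pos hD0]; congr 1; field_simp
  rw [h2] at h1
  exact h1

/-- **The explicit density constant of the law at lattice time `2`**: with `C₁ = e^{48|β'|#E·2 + 2|β'|#𝒫}·2(3/2)^{#E}` and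
`a = e^{4|β'|#𝒫}e^{4|β'|#𝒫}`, the product `D = C₁·a` satisfies `e ≤ D` and `log D = 96|β'|#E + 10|β'|#𝒫 + log 2 + #E·log(3/2)`. [folklore] -/
theorem coldStart_density_constant_facts (L : ℕ) [NeZero L] (β' : ℝ) :
    Real.exp 1 ≤ (Real.exp ((48 * |β'| * (Fintype.card (Edge 3 L) : ℝ)) * ((2 : ℝ≥0) : ℝ) +
        (2 * |β'| * (Fintype.card (Plaquette 3 L) : ℝ))) * (2 * (3 / 2 : ℝ) ^ Fintype.card (Edge 3 L))) *
        (Real.exp (|β'| * (4 * (Fintype.card (Plaquette 3 L) : ℝ))) * Real.exp (|β'| * (4 * (Fintype.card (Plaquette 3 L) : ℝ)))) ∧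
      Real.log ((Real.exp ((48 * |β'| * (Fintype.card (Edge 3 L) : ℝ)) * ((2 : ℝ≥0) : ℝ) +
        (2 * |β'| * (Fintype.card (Plaquette 3 L) : ℝ))) * (2 * (3 / 2 : ℝ) ^ Fintype.card (Edge 3 L))) *
        (Real.exp (|β'| * (4 * (Fintype.card (Plaquette 3 L) : ℝ))) * Real.exp (|β'| * (4 * (Fintype.card (Plaquette 3 L) : ℝ))))) =
        96 * |β'| * (Fintype.card (Edge 3 L) : ℝ) + 10 * |β'| * (Fintype.card (Plaquette 3 L) : ℝ) + Real.log 2 +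
          (Fintype.card (Edge 3 L) : ℝ) * Real.log (3 / 2) := by
  set nE : ℕ := Fintype.card (Edge 3 L) with hnE
  set P : ℝ := (Fintype.card (Plaquette 3 L) : ℝ) with hP
  have hnE1 : 1 ≤ nE := Fintype.card_pos_iff.2 ⟨((fun _ => 0), 0)⟩
  -- collect the exponentials
  set s : ℝ := (48 * |β'| * (nE : ℝ)) * ((2 : ℝ≥0) : ℝ) + (2 * |β'| * P) + |β'| * (4 * P) + |β'| * (4 * P) with hs
  have eD : (Real.exp ((48 * |β'| * (nE : ℝ)) * ((2 : ℝ≥0) : ℝ) + (2 * |β'| * P)) * (2 * (3 / 2 : ℝ) ^ nE)) *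
      (Real.exp (|β'| * (4 * P)) * Real.exp (|β'| * (4 * P))) = Real.exp s * (2 * (3 / 2 : ℝ) ^ nE) := by
    rw [hs]; simp only [Real.exp_add]; ring
  have hpow1 : (3 / 2 : ℝ) ≤ (3 / 2 : ℝ) ^ nE := by
    calc (3 / 2 : ℝ) = (3 / 2 : ℝ) ^ 1 := (pow_one _).symm
      _ ≤ (3 / 2 : ℝ) ^ nE := pow_le_pow_right₀ (by norm_num) hnE1
  have hs0 : 0 ≤ s := by rw [hs]; positivity
  refine ⟨?_, ?_⟩
  · rw [eD]
    have h1 : (1 : ℝ) ≤ Real.exp s := Real.one_le_exp hs0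
    have h3 : (3 : ℝ) ≤ Real.exp s * (2 * (3 / 2 : ℝ) ^ nE) := by nlinarith
    have he : Real.exp 1 < 3 := lt_trans Real.exp_one_lt_d9 (by norm_num)
    linarith
  · rw [eD, Real.log_mul (Real.exp_pos s).ne' (by positivity), Real.log_exp,
      Real.log_mul (by norm_num) (by positivity), Real.log_pow, hs]
    push_cast
    ring

/-! ## §2. Cold-start `L²`-mixing with the hypercontractive burn-in -/

/-- ★★★ **Cold-start `L²`-mixing of the SZZ dynamics in `O(log L)` lattice time at `|β'| < 1/12`.**  For every `L`, every
`|β'| < 1/12`, every deterministic start `z`, EVERY strong solution `U` from `z` on ANY filtered probability space, every bounded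
measurable `F` and all `t₀, s ≥ 0` with `log B ≤ 2(1 − 12|β'|)·t₀`, `B = 96|β'|#E + 10|β'|#𝒫 + log 2 + #E·log(3/2)`:

  `|∫ F(U_{2+t₀+s}) dP − ∫ F dμ_{β'}| ≤ e · e^{−(1−12|β'|)s} · (∫ (F − μF)² dμ_{β'})^{1/2}`

(`law(U₂) ≤ e^B·μ`; Markov property; `wilson_hypercontractive_mixing`-type bound with `q − 1 = e^{2(1−12|β'|)t₀} ≥ B = log D`).
[cite: DiaconisSaloffcoste1996, Theorem 3.7] [cite: ShenZhuZhu2022, Corollary 4.4] -/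
theorem coldStart_hypercontractive_mixing_uniform (L : ℕ) [NeZero L] (β' : ℝ) (hβ : |β'| < 1 / 12)
    (z : GaugeConfig 3 L (Matrix.specialUnitaryGroup (Fin 2) ℂ))
    {Ω : Type} [MeasurableSpace Ω] {P : Measure Ω} [IsProbabilityMeasure P]
    {W : ℝ≥0 → Ω → (Edge 3 L × NoiseIdx 2 → ℝ)} (hW : IsFlatBrownian W P)
    {U : ℝ≥0 → Ω → GaugeConfig 3 L (Matrix.specialUnitaryGroup (Fin 2) ℂ)} (hU0 : ∀ ω, U 0 ω = z)
    (hU : (latticeLangevinDynamics (fundamentalLatticeRep 2) β').IsSolution (fundamentalRep (Fin 2)) hW.natFiltration P W U)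
    {F : GaugeConfig 3 L (Matrix.specialUnitaryGroup (Fin 2) ℂ) → ℝ} (hF : Measurable F) {M : ℝ} (hM : ∀ x, |F x| ≤ M)
    (t₀ s : ℝ≥0)
    (ht₀ : Real.log (96 * |β'| * (Fintype.card (Edge 3 L) : ℝ) + 10 * |β'| * (Fintype.card (Plaquette 3 L) : ℝ) + Real.log 2 +
      (Fintype.card (Edge 3 L) : ℝ) * Real.log (3 / 2)) ≤ 2 * (1 - 12 * |β'|) * t₀) :
    |(∫ ω, F (U (2 + t₀ + s) ω) ∂P) - ∫ x, F x ∂(wilsonMeasure (d := 3) (L := L) (fundamentalRep (Fin 2)) β')| ≤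
      Real.exp 1 * Real.exp (-(1 - 12 * |β'|) * s) *
        (∫ x, (F x - ∫ z, F z ∂(wilsonMeasure (d := 3) (L := L) (fundamentalRep (Fin 2)) β')) ^ 2
          ∂(wilsonMeasure (d := 3) (L := L) (fundamentalRep (Fin 2)) β')) ^ (1 / (2 : ℝ)) := by
  classical
  haveI := secondCountableTopology_su2
  haveI := borelSpace_config L
  haveI : IsProbabilityMeasure (wilsonMeasure (d := 3) (L := L) (fundamentalRep (Fin 2)) β') :=
    isProbabilityMeasure_wilsonMeasure (d := 3) (L := L) (fundamentalRep (Fin 2)) (continuous_fundamentalRep (Fin 2)) β'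
  -- THE kernels, the density bound at time `2`
  obtain ⟨κ, hκM, -, hreal⟩ := exists_transitionKernel L β'
  haveI := hκM
  obtain ⟨hDe, hlogD⟩ := coldStart_density_constant_facts L β'
  obtain ⟨D, hDdef⟩ : ∃ D : ℝ, (Real.exp ((48 * |β'| * (Fintype.card (Edge 3 L) : ℝ)) * ((2 : ℝ≥0) : ℝ) +
      (2 * |β'| * (Fintype.card (Plaquette 3 L) : ℝ))) * (2 * (3 / 2 : ℝ) ^ Fintype.card (Edge 3 L))) *
      (Real.exp (|β'| * (4 * (Fintype.card (Plaquette 3 L) : ℝ))) * Real.exp (|β'| * (4 * (Fintype.card (Plaquette 3 L) : ℝ)))) = D :=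
    ⟨_, rfl⟩
  rw [hDdef] at hDe hlogD
  have hD0 : 0 ≤ D := (Real.exp_pos 1).le.trans hDe
  have hle₁ := map_le_smul_haar_explicit (L := L) β' (t := 2) (by norm_num) z hW hU0 hU
  obtain ⟨-, hπle⟩ := wilsonMeasure_le_smul_pi_haar_and_explicit (L := L) β'
  have hν : P.map (U 2) ≤ (ENNReal.ofReal D) • wilsonMeasure (d := 3) (L := L) (fundamentalRep (Fin 2)) β' := by
    rw [← hDdef, ENNReal.ofReal_mul (by positivity), Measure.le_iff]
    intro A hA
    have e1 := Measure.le_iff.1 hle₁ A hA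
    have e2 := Measure.le_iff.1 hπle A hA
    simp only [Measure.smul_apply, smul_eq_mul] at e1 e2 ⊢
    calc (P.map (U 2)) A ≤ _ := e1
      _ ≤ _ := mul_le_mul' le_rfl e2
      _ = _ := (mul_assoc _ _ _).symm
  haveI : IsProbabilityMeasure (P.map (U 2)) :=
    Measure.isProbabilityMeasure_map ((hU.adapted 2).mono (hW.natFiltration.le 2) le_rfl).aemeasurable
  -- Markov: `E F(U_{2+t}) = ∫ κ_t F d law(U₂)`
  have hmU : Measurable (U (2 + t₀ + s)) := (hU.adapted _).mono (hW.natFiltration.le _) le_rfl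
  have hE : ∫ ω, F (U (2 + t₀ + s) ω) ∂P = ∫ y, (∫ y', F y' ∂(κ (t₀ + s) y)) ∂(P.map (U 2)) := by
    rw [← integral_map hmU.aemeasurable hF.aestronglyMeasurable, ← hreal (2 + t₀ + s) z Ω P W hW U hU0 hU, add_assoc,
      chapmanKolmogorov_szz β' κ hreal 2 (t₀ + s), ← hreal 2 z Ω P W hW U hU0 hU]
    haveI : IsProbabilityMeasure ((κ (t₀ + s) ∘ₖ κ 2) z) := by
      rw [← chapmanKolmogorov_szz β' κ hreal 2 (t₀ + s)]; infer_instance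
    exact Kernel.integral_comp (integrable_of_abs_le _ hF hM)
  rw [hE]
  -- the hypercontractive bound with `ρ = (1 − 12|β'|)/2`, `λ = 1 − 12|β'|`
  have hρ : 0 ≤ (1 - 12 * |β'|) / 2 := by linarith
  have h := abs_integral_transition_sub_le_of_hypercontractive L β' κ hreal hρ
    (fun g hg => wilson_generatorLogSobolev_uniform L β' hβ g hg) (lam := 1 - 12 * |β'|)
    (fun G hG M' hM' t => wilson_spectralGap_uniform_measurable L β' hβ κ hreal hG hM' t) hD0 hν hF hM t₀ s
  -- `D^{1/q} ≤ e` since `q − 1 = e^{2(1−12|β'|)t₀} ≥ B = log D`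
  have hq : Real.log D ≤ 1 + Real.exp (4 * ((1 - 12 * |β'|) / 2) * t₀) := by
    have h1 : Real.log (Real.log D) ≤ 4 * ((1 - 12 * |β'|) / 2) * t₀ := by rw [hlogD]; linarith
    have hlogpos : 0 < Real.log D := by
      have := Real.log_le_log (Real.exp_pos 1) hDe
      rw [Real.log_exp] at this; linarith
    have h2 : Real.log D ≤ Real.exp (4 * ((1 - 12 * |β'|) / 2) * t₀) := by
      calc Real.log D = Real.exp (Real.log (Real.log D)) := (Real.exp_log hlogpos).symm
        _ ≤ _ := Real.exp_le_exp.2 h1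
    linarith
  have hDq := rpow_one_div_le_exp_of_log_le hDe hq
  have hrest : 0 ≤ Real.exp (-(1 - 12 * |β'|) * s) *
      (∫ x, (F x - ∫ z, F z ∂(wilsonMeasure (d := 3) (L := L) (fundamentalRep (Fin 2)) β')) ^ 2
        ∂(wilsonMeasure (d := 3) (L := L) (fundamentalRep (Fin 2)) β')) ^ (1 / (2 : ℝ)) :=
    mul_nonneg (Real.exp_pos _).le (Real.rpow_nonneg (integral_nonneg fun x => sq_nonneg _) _)
  have h2 := mul_le_mul_of_nonneg_right hDq hrest
  exact h.trans (by simpa only [mul_assoc] using h2)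

/-- ★★ **Cold-start `L²`-mixing with the hypercontractive burn-in at EVERY `(L, β')`.**  With `ρ = ½e^{−|β'|·4·#𝒫}` (Holley–Stroock
log-Sobolev) and `λ = (3/2)e^{−|β'|·4·#𝒫}` (`L²` gap): for every deterministic start `z`, every solution `U` from `z` on any space, every
bounded measurable `F`, all `t₀, s ≥ 0` with `log B ≤ 4ρt₀` (`B` as above):
`|∫ F(U_{2+t₀+s}) dP − ∫ F dμ_{β'}| ≤ e · e^{−λs} · (∫ (F − μF)² dμ_{β'})^{1/2}`.  HONEST: at a general `β'` the constants `ρ, λ` are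
themselves `e^{−O(L³)}`; only the shape `log B` (not `B`) of the burn-in is the point. [cite: DiaconisSaloffcoste1996, Theorem 3.7] -/
theorem coldStart_hypercontractive_mixing_explicit (L : ℕ) [NeZero L] (β' : ℝ)
    (z : GaugeConfig 3 L (Matrix.specialUnitaryGroup (Fin 2) ℂ))
    {Ω : Type} [MeasurableSpace Ω] {P : Measure Ω} [IsProbabilityMeasure P]
    {W : ℝ≥0 → Ω → (Edge 3 L × NoiseIdx 2 → ℝ)} (hW : IsFlatBrownian W P)
    {U : ℝ≥0 → Ω → GaugeConfig 3 L (Matrix.specialUnitaryGroup (Fin 2) ℂ)} (hU0 : ∀ ω, U 0 ω = z)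
    (hU : (latticeLangevinDynamics (fundamentalLatticeRep 2) β').IsSolution (fundamentalRep (Fin 2)) hW.natFiltration P W U)
    {F : GaugeConfig 3 L (Matrix.specialUnitaryGroup (Fin 2) ℂ) → ℝ} (hF : Measurable F) {M : ℝ} (hM : ∀ x, |F x| ≤ M)
    (t₀ s : ℝ≥0)
    (ht₀ : Real.log (96 * |β'| * (Fintype.card (Edge 3 L) : ℝ) + 10 * |β'| * (Fintype.card (Plaquette 3 L) : ℝ) + Real.log 2 +
      (Fintype.card (Edge 3 L) : ℝ) * Real.log (3 / 2)) ≤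
        4 * ((1 / 2 : ℝ) * Real.exp (-(|β'| * (4 * (Fintype.card (Plaquette 3 L) : ℝ))))) * t₀) :
    |(∫ ω, F (U (2 + t₀ + s) ω) ∂P) - ∫ x, F x ∂(wilsonMeasure (d := 3) (L := L) (fundamentalRep (Fin 2)) β')| ≤
      Real.exp 1 * Real.exp (-((3 / 2 : ℝ) * Real.exp (-(|β'| * (4 * (Fintype.card (Plaquette 3 L) : ℝ))))) * s) *
        (∫ x, (F x - ∫ z, F z ∂(wilsonMeasure (d := 3) (L := L) (fundamentalRep (Fin 2)) β')) ^ 2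
          ∂(wilsonMeasure (d := 3) (L := L) (fundamentalRep (Fin 2)) β')) ^ (1 / (2 : ℝ)) := by
  classical
  haveI := secondCountableTopology_su2
  haveI := borelSpace_config L
  haveI : IsProbabilityMeasure (wilsonMeasure (d := 3) (L := L) (fundamentalRep (Fin 2)) β') :=
    isProbabilityMeasure_wilsonMeasure (d := 3) (L := L) (fundamentalRep (Fin 2)) (continuous_fundamentalRep (Fin 2)) β'
  obtain ⟨κ, hκM, -, hreal⟩ := exists_transitionKernel L β'
  haveI := hκM
  obtain ⟨hDe, hlogD⟩ := coldStart_density_constant_facts L β'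
  obtain ⟨D, hDdef⟩ : ∃ D : ℝ, (Real.exp ((48 * |β'| * (Fintype.card (Edge 3 L) : ℝ)) * ((2 : ℝ≥0) : ℝ) +
      (2 * |β'| * (Fintype.card (Plaquette 3 L) : ℝ))) * (2 * (3 / 2 : ℝ) ^ Fintype.card (Edge 3 L))) *
      (Real.exp (|β'| * (4 * (Fintype.card (Plaquette 3 L) : ℝ))) * Real.exp (|β'| * (4 * (Fintype.card (Plaquette 3 L) : ℝ)))) = D :=
    ⟨_, rfl⟩
  rw [hDdef] at hDe hlogD
  have hD0 : 0 ≤ D := (Real.exp_pos 1).le.trans hDe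
  have hle₁ := map_le_smul_haar_explicit (L := L) β' (t := 2) (by norm_num) z hW hU0 hU
  obtain ⟨-, hπle⟩ := wilsonMeasure_le_smul_pi_haar_and_explicit (L := L) β'
  have hν : P.map (U 2) ≤ (ENNReal.ofReal D) • wilsonMeasure (d := 3) (L := L) (fundamentalRep (Fin 2)) β' := by
    rw [← hDdef, ENNReal.ofReal_mul (by positivity), Measure.le_iff]
    intro A hA
    have e1 := Measure.le_iff.1 hle₁ A hA
    have e2 := Measure.le_iff.1 hπle A hA
    simp only [Measure.smul_apply, smul_eq_mul] at e1 e2 ⊢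
    calc (P.map (U 2)) A ≤ _ := e1
      _ ≤ _ := mul_le_mul' le_rfl e2
      _ = _ := (mul_assoc _ _ _).symm
  haveI : IsProbabilityMeasure (P.map (U 2)) :=
    Measure.isProbabilityMeasure_map ((hU.adapted 2).mono (hW.natFiltration.le 2) le_rfl).aemeasurable
  have hmU : Measurable (U (2 + t₀ + s)) := (hU.adapted _).mono (hW.natFiltration.le _) le_rfl
  have hE : ∫ ω, F (U (2 + t₀ + s) ω) ∂P = ∫ y, (∫ y', F y' ∂(κ (t₀ + s) y)) ∂(P.map (U 2)) := by
    rw [← integral_map hmU.aemeasurable hF.aestronglyMeasurable, ← hreal (2 + t₀ + s) z Ω P W hW U hU0 hU, add_assoc,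
      chapmanKolmogorov_szz β' κ hreal 2 (t₀ + s), ← hreal 2 z Ω P W hW U hU0 hU]
    haveI : IsProbabilityMeasure ((κ (t₀ + s) ∘ₖ κ 2) z) := by
      rw [← chapmanKolmogorov_szz β' κ hreal 2 (t₀ + s)]; infer_instance
    exact Kernel.integral_comp (integrable_of_abs_le _ hF hM)
  rw [hE]
  set ρ : ℝ := (1 / 2 : ℝ) * Real.exp (-(|β'| * (4 * (Fintype.card (Plaquette 3 L) : ℝ)))) with hρdef
  have hρ : 0 ≤ ρ := by rw [hρdef]; positivity
  have h := abs_integral_transition_sub_le_of_hypercontractive L β' κ hreal hρ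
    (fun g hg => wilson_generatorLogSobolev_explicit L β' g hg)
    (lam := (3 / 2 : ℝ) * Real.exp (-(|β'| * (4 * (Fintype.card (Plaquette 3 L) : ℝ)))))
    (fun G hG M' hM' t => wilson_spectralGap_explicit_measurable L β' κ hreal hG hM' t) hD0 hν hF hM t₀ s
  have hq : Real.log D ≤ 1 + Real.exp (4 * ρ * t₀) := by
    have h1 : Real.log (Real.log D) ≤ 4 * ρ * t₀ := by rw [hlogD]; exact ht₀
    have hlogpos : 0 < Real.log D := by
      have := Real.log_le_log (Real.exp_pos 1) hDe
      rw [Real.log_exp] at this; linarith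
    have h2 : Real.log D ≤ Real.exp (4 * ρ * t₀) := by
      calc Real.log D = Real.exp (Real.log (Real.log D)) := (Real.exp_log hlogpos).symm
        _ ≤ _ := Real.exp_le_exp.2 h1
    linarith
  have hDq := rpow_one_div_le_exp_of_log_le hDe hq
  have hrest : 0 ≤ Real.exp (-((3 / 2 : ℝ) * Real.exp (-(|β'| * (4 * (Fintype.card (Plaquette 3 L) : ℝ))))) * s) *
      (∫ x, (F x - ∫ z, F z ∂(wilsonMeasure (d := 3) (L := L) (fundamentalRep (Fin 2)) β')) ^ 2
        ∂(wilsonMeasure (d := 3) (L := L) (fundamentalRep (Fin 2)) β')) ^ (1 / (2 : ℝ)) :=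
    mul_nonneg (Real.exp_pos _).le (Real.rpow_nonneg (integral_nonneg fun x => sq_nonneg _) _)
  have h2 := mul_le_mul_of_nonneg_right hDq hrest
  exact h.trans (by simpa only [mul_assoc] using h2)

/-- ★★ **Cold-start mixing of EVENTS in `O(log L)` lattice time at `|β'| < 1/12`.**  Under the hypotheses of
`coldStart_hypercontractive_mixing_uniform` (`log B ≤ 2(1−12|β'|)t₀`), for every measurable set `A` and every `s ≥ 0`:
`|P(U_{2+t₀+s} ∈ A) − μ_{β'}(A)| ≤ e · e^{−(1−12|β'|)s} · √(μ_{β'}(A)(1 − μ_{β'}(A)))` — in particular the TOTAL-VARIATION distance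
to `μ_{β'}` is `≤ (e/2)e^{−(1−12|β'|)s}` after `2 + log B/(2(1−12|β'|))` lattice units. [cite: DiaconisSaloffcoste1996, Theorem 3.7] -/
theorem coldStart_hypercontractive_mixing_uniform_event (L : ℕ) [NeZero L] (β' : ℝ) (hβ : |β'| < 1 / 12)
    (z : GaugeConfig 3 L (Matrix.specialUnitaryGroup (Fin 2) ℂ))
    {Ω : Type} [MeasurableSpace Ω] {P : Measure Ω} [IsProbabilityMeasure P]
    {W : ℝ≥0 → Ω → (Edge 3 L × NoiseIdx 2 → ℝ)} (hW : IsFlatBrownian W P)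
    {U : ℝ≥0 → Ω → GaugeConfig 3 L (Matrix.specialUnitaryGroup (Fin 2) ℂ)} (hU0 : ∀ ω, U 0 ω = z)
    (hU : (latticeLangevinDynamics (fundamentalLatticeRep 2) β').IsSolution (fundamentalRep (Fin 2)) hW.natFiltration P W U)
    {A : Set (GaugeConfig 3 L (Matrix.specialUnitaryGroup (Fin 2) ℂ))} (hA : MeasurableSet A) (t₀ s : ℝ≥0)
    (ht₀ : Real.log (96 * |β'| * (Fintype.card (Edge 3 L) : ℝ) + 10 * |β'| * (Fintype.card (Plaquette 3 L) : ℝ) + Real.log 2 +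
      (Fintype.card (Edge 3 L) : ℝ) * Real.log (3 / 2)) ≤ 2 * (1 - 12 * |β'|) * t₀) :
    |(P.map (U (2 + t₀ + s))).real A - (wilsonMeasure (d := 3) (L := L) (fundamentalRep (Fin 2)) β').real A| ≤
      Real.exp 1 * Real.exp (-(1 - 12 * |β'|) * s) *
        ((wilsonMeasure (d := 3) (L := L) (fundamentalRep (Fin 2)) β').real A *
          (1 - (wilsonMeasure (d := 3) (L := L) (fundamentalRep (Fin 2)) β').real A)) ^ (1 / (2 : ℝ)) := by
  classical
  haveI := secondCountableTopology_su2
  haveI := borelSpace_config L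
  haveI : IsProbabilityMeasure (wilsonMeasure (d := 3) (L := L) (fundamentalRep (Fin 2)) β') :=
    isProbabilityMeasure_wilsonMeasure (d := 3) (L := L) (fundamentalRep (Fin 2)) (continuous_fundamentalRep (Fin 2)) β'
  have h1A : ∀ x : GaugeConfig 3 L (Matrix.specialUnitaryGroup (Fin 2) ℂ),
      |A.indicator (1 : GaugeConfig 3 L (Matrix.specialUnitaryGroup (Fin 2) ℂ) → ℝ) x| ≤ 1 := by
    intro x
    by_cases hx : x ∈ A
    · simp [Set.indicator_of_mem hx]
    · simp [Set.indicator_of_notMem hx]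
  have h := coldStart_hypercontractive_mixing_uniform L β' hβ z hW hU0 hU (measurable_one.indicator hA) h1A t₀ s ht₀
  have hmU : Measurable (U (2 + t₀ + s)) := (hU.adapted _).mono (hW.natFiltration.le _) le_rfl
  have e1 : ∫ ω, A.indicator (1 : GaugeConfig 3 L (Matrix.specialUnitaryGroup (Fin 2) ℂ) → ℝ) (U (2 + t₀ + s) ω) ∂P =
      (P.map (U (2 + t₀ + s))).real A := by
    rw [← integral_map hmU.aemeasurable ((measurable_one.indicator hA).aestronglyMeasurable), integral_indicator_one hA]
  rw [e1, integral_indicator_one hA, integral_indicator_sub_sq _ hA] at h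
  exact h

end Summit.QuantumFields.YangMills.Theorems.ColdStartUniversality

end
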